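import Mathlib
import HarnessLib
import HarnessLib.Audit
import Summits.NavierStokesRegularity.Statement
import Literature.Analysis.FluidPDE.ClassicalSolution
import Literature.Analysis.FluidPDE.LerayHopf
import Literature.Analysis.FluidPDE.NSWave0
import Summits.NavierStokesRegularity.NavierStokesRegularity.Theorems.TypeICertificateLadderNoBlowupToClay
import HarnessLib.Audit.Status.Attr

/-!
Route: SwallowedContinuum

DORMANT since 2026-09-01T12:17:20Z (reconciler: no traction for 5 d (last activity statement-closed at 2026-08-27T11:25:11Z); parked, not closed — `ledger route dormant route-NavierStokesRegularity-SwallowedContinuum --off` to reactivat) — unstaffed, not closed; items shared with open routes are served there. `ledger route dormant <id> --off` reactivates.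

# Route SwallowedContinuum — every singularity swallows a cellular continuum — exclude disc,
disc-free and collision-free collapses

POSITIVE side of Clay (A), realising card singularity-swallows-cellular-continuum (spine, sole
card). New object: the LAGRANGIAN ENDPOINT MAP of a putative first singularity. For a classical
solution (u,p) on ℝ³×[0,T), Leray–Hopf from a rapidly decaying datum, Tao's a-priori bounded total
speed ∫₀ᵀ‖u(t)‖_∞dt < ∞ makes the particle-trajectory maps X(t,·) uniformly Cauchy, so they converge
uniformly to a continuous, proper, onto, Lebesgue-preserving endpoint map Xs, a uniform limit of
volume-preserving diffeomorphisms (a near-homeomorphism of ℝ³); its fibres Xs⁻¹{x} are the SWALLOWED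
SETS (cellular continua by Bing–Armentrout decomposition theory; single labels over regular points).
By pure logic every fibre is a point, a nondegenerate continuum containing no embedded closed
2-disc, or contains an embedded closed 2-disc. It suffices to show X = X₁ ∧ X₂ ∧ X₃: X₁
(NoDiscSwallow) no swallowed set contains an embedded closed 2-disc; X₂ (NoDiscFreeCollapse) every
nondegenerate swallowed set contains one (so disc-free continua — arcs, dendrites — are never
swallowed); X₃ (NoCollisionFreeBlowup) if Xs is injective (no two fluid particles collide at time T)
the solution extends smoothly past T.
Lean: `NoDiscSwallow ∧ NoDiscFreeCollapse ∧ NoCollisionFreeBlowup`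

## Assembly
Pure logic, sorry-free in the planner's Sketch.lean and in glue.lean (lean check rc 0):
NoBlowupToClay (stmt-NavierStokesRegularity-0055) is PROVED in tree
(Theorems.typeICertificateLadder_noBlowupToClay_proof) and is invoked by name, so `closes` reduces
Clay (A) to NoBlowup; given (ν,T,u,p), EndpointMapExists hands X and Xs; NoDiscSwallow forbids a
disc in any fibre and NoDiscFreeCollapse puts a disc in any nondegenerate fibre, so every fibre is a
subsingleton, i.e. Xs is injective; NoCollisionFreeBlowup then gives HasSmoothExtensionPast ν 0 u T.
~12 lines.

Rationale: WHY THIS LINE. Nobody has taken the uniform limit of the flow maps AT the blow-up time: doing so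
hands the singularity to 3-manifold decomposition theory (Daverman1986 §II.5–6,
doi:10.1090/memo/0107), which returns a rigid invariant — the swallowed set is a cellular continuum
(compact, connected, no circle, no sphere, no Whitehead continuum), one label over every regular
point (doi:10.1088/0951-7715/22/9/002 is the measure-theoretic shadow) — and splits Clay (A) into
three structurally different exclusions whose census is PROVED by logic: membrane (disc) swallow =
the tornado/Hou geometry (Hou2022PotentiallySingularNS), disc-free swallow = axial/sheet-forming
collapse (Elgindi2021-type strain signature), collision-free = pure winding/shear blow-up. Imported
areas: geometric topology (cellular decompositions, near-homeomorphisms), Lagrangian a-priori theory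
of NS (Tao2011 Prop. 9.1, FoiasGuillopeTemam1981), Type-I tangent-flow theory for the first split of
each sector (KNSS2009, SereginSverak2009: in Leray similarity variables the swallowed set is the
bounded-orbit set of ẏ = U + y/2, div = 3/2). What no listed route does: all 57 classify a
singularity Eulerianly (rate, profile, symmetry, vorticity direction, pressure); none uses particle
trajectories, the endpoint map or decomposition-space topology, and the in-tree averaged Type-I pump
(Theorems.PerpetualPumpAveragedTypeIBlowup) shows positive cruxes must name a fine-structure input —
transport structure is exactly one the averaged class cannot even formulate.

RANKED CRUXES. #2 NoDiscSwallow (crux) — for every ν>0, T>0, every classical solution (u,p) of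
unforced NS on ℝ³×[0,T) that is Leray–Hopf on [0,T] from a rapidly decaying datum, every flow map X
of u on [0,T) (X(0,a)=a, ∂ₛX(s,a)=u(s,X(s,a)) within [0,T)) and every uniform limit Xs of X(t,·) as
t↑T: no fibre Xs⁻¹{x} contains the image of the closed unit 2-disc under a map continuous and
injective on it (no MEMBRANE is swallowed; card K1, the tornado sector). [difficulty: open-problem]
(why it might fail: this is exactly the tornado: Hou's interior axisymmetric candidate
(arXiv:2107.06509) swallows the equatorial disc; axisymmetric Type I is excluded (KNSS2009), so the
disc sector is Type II, where Kelvin-on-membrane-loops is the amplification mechanism, not yet an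
obstruction.) [Hou2022PotentiallySingularNS, arXiv:2107.06509, KNSS2009, SereginSverak2009,
LuoHou2014, Tao2011]
#3 NoDiscFreeCollapse (crux) — same hypotheses: every NONDEGENERATE fibre Xs⁻¹{x} (more than one
label swallowed) contains the image of the closed unit 2-disc under a map continuous and injective
on it — i.e. a first singularity never swallows only a disc-free continuum (material arc / dendrite
crushed to a point: one contracting direction, sheet-forming strain; card K2). [difficulty:
open-problem] (why it might fail: axial-strain collapses (Elgindi's C^{1,α} Euler blow-up crushes a
material axis segment; antiparallel/iterated-sheet scenarios) are arc-type; vortex-layer zoom limits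
are unstable rather than provably harmless; a 2-dim swallowed continuum with no disc also falsifies
it as typed.) [Elgindi2021, doi:10.1007/s00205-019-01419-1, BrennerHormozPumir2016, ChenHou2022,
Tao2011]
#4 NoCollisionFreeBlowup (crux) — same hypotheses: if the endpoint map Xs is injective (no two fluid
particles collide at time T; every swallowed set is a single label) then u extends as a classical
solution past T — "what blows up must bring fluid particles together" (card K3, the point sector).
[difficulty: open-problem] (why it might fail: a confined infinitely-winding swirl (Θ ~ r^{-1/2})
has a homeomorphic endpoint map yet unbounded velocity: collision-free blow-up is KINEMATICALLY
admissible under bounded total speed, so the crux needs dynamics (spin-up without radial inflow),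
and no tool for that is in print.) [doi:10.1088/0951-7715/22/9/002, Tao2011,
ConstantinIgnatovaVicol2026, BealeKatoMajda1984]
#9 EndpointMapExists (support) — for every classical Leray–Hopf solution from a rapidly decaying
datum on [0,T) there exist a flow map X on [0,T) and a uniform limit Xs of X(t,·) as t↑T
(Picard–Lindelöf for the bounded smooth field on each [0,t], t<T — u is the mild H^k solution by
weak–strong uniqueness — and the Cauchy criterion from bounded total speed, Tao 2013 Prop. 9.1, in
tree as tao2011_boundedTotalSpeed_unit after ν-scaling). The only binder of `closes` that is not a
crux. [difficulty: M] [Tao2011, FoiasGuillopeTemam1981, RobinsonRodrigoSadowski2016]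
#9 FibreCellular (support) — same hypotheses: every nonempty fibre Xs⁻¹{x} is CELLULAR — inside
every open neighbourhood U it lies in the interior of an embedded closed 3-cell e(B̄³) ⊆ U (Xs is a
proper near-homeomorphism: Bing's shrinkability criterion ⇔ near-homeomorphism for the induced usc
decomposition, and elements of shrinkable decompositions of 3-manifolds are cellular, Daverman1986
§II.5 and §II.6 Prop. 1; Armentrout 1971 for cellular maps of 3-manifolds). Hence swallowed sets are
compact, connected, Lebesgue-null, contain no circle or closed surface. Not a binder of `closes`
(structure behind the census). [difficulty: XL] [Daverman1986, doi:10.1090/memo/0107,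
doi:10.1016/0040-9383(72)90014-6, Tao2011]
#9 RegularFibreTrivial (support) — same hypotheses: over a point x near which u stays bounded up to
T from below (∃ r, M: ‖u‖ ≤ M on B(x,r)×[T−r²,T)) the fibre Xs⁻¹{x} has at most one label (interior
regularity gives a Lipschitz field up to T near x; backward ODE uniqueness through the common
endpoint). Hence nondegenerate swallowed sets sit only over singular points. Provable now; not a
binder of `closes`. [difficulty: provable-now] [doi:10.1088/0951-7715/22/9/002,
CaffarelliKohnNirenberg1982, LemarieRieusset2016]

TWO-LAYER PLAN. Foreseen glued splits (nothing filed now; the BC3 birth skeletons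
bc/<Crux>_birth.lean realise the first one per crux): each sector K ⇐ K_TypeI → K_notTypeI → K,
split by the in-tree rate predicate IsTypeIBlowup u T. In the Type-I branch with a converging (D)SS
similarity frame the swallowed set is the bounded-forward-orbit set of the similarity dynamics ẏ =
U(y,s) + y/2 (div = 3/2, so at most two contracting directions, and at least one bounded orbit by
degree), so NoDiscSwallow_TypeI reads "no Type-I tangent flow has a bounded invariant set with a
2-dimensional stable set" and NoCollisionFreeBlowup_TypeI reads "a Type-I profile whose bounded
orbits are all sources is trivial" — Liouville statements about the STAGNATION STRUCTURE of Type-I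
profiles, a reading no Type-I route has. Later: FibreCellular ⇐ (near-homeomorphism ⇒ shrinkable) →
(shrinkable ⇒ cellular).

KILL CRITERIA. Any certified finite-energy blow-up (route CertifiedBlowup, or a proof of Hou's
interior scenario) refutes the crux of its Lagrangian type (Hou: NoDiscSwallow) and Clay together —
close `refuted:<that crux>`. A kinematic theorem "bounded total speed + energy class + local energy
inequality already force collisions at an unbounded point" would PROVE NoCollisionFreeBlowup
outright (move it to support); conversely an explicit finite-energy, bounded-total-speed
divergence-free field obeying every known a-priori NS bound with an injective endpoint map and
unbounded velocity shows the crux is dynamics-only (record as a barrier note, keep the crux). A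
trajectory computation on published near-singular fields (Hou 2022, Kerr, Brenner–Hormoz–Pumir)
classifying the pre-image geometry as a disc for the strongest candidate makes NoDiscSwallow
"predicted false" and sends the route to the negative side (pivot: realise the disc sector as a ¬A
scenario route). NoBlowup proved elsewhere moots everything; a refutation of EndpointMapExists (it
is Tao's Prop. 9.1 + ODE theory) would be a misstatement to repair.

NOT DECOMPOSED YET. The Type-I/not-Type-I split of each sector (layer-2 children, skeletons
written); the similarity-dynamics identification of the swallowed set for Type-I points (card P3);
Kelvin-on-membrane-loops lower bounds in the disc sector; the quantitative link between swallowing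
speed δ(t) = ∫_t^T ‖u‖_∞ and the rate; the formal decomposition-space theory behind FibreCellular
(Mathlib has none — it is a support nobody needs for `closes`).

CHEAPEST FALSIFIER. Run by the planner: (i) the trichotomy is pure logic and `closes` elaborates (rc
0); (ii) the rest state u ≡ 0 satisfies NoDiscSwallow sorry-free (bc/NoDiscSwallow_special.lean, rc
0: zero right-derivative ⇒ frozen labels ⇒ Xs = id ⇒ no disc in a point); (iii) all three census
classes are kinematically inhabited by bounded-total-speed divergence-free cartoons (plane inflow +
axial jet = disc; axial compression = arc; confined infinite-winding swirl = collision-free), so no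
sector is vacuous. Cheapest external check for a refuter: the literature claim behind FibreCellular
in the NON-compact case (near-homeomorphism of ℝ³ with bounded displacement ⇒ cellular fibres via
the one-point compactification) — a pure-topology lookup (Daverman1986 §II.5–6).

NUMBERS. Bounded total speed (Tao2011 Prop. 9.1, ν = 1): ∫₀ᵀ‖u‖_∞ ≤ K(E^{1/2}T^{1/4} + E). CKN:
𝓟¹(singular set) = 0, so the singular fibres are indexed by a compact totally disconnected set.
Similarity dynamics: div(U + y/2) = 3/2 ⇒ swallowed sets of Type-I points have dimension ≤ 2
dynamically as well as topologically. Items at open: 7 (3 cruxes, 3 supports, 1 assembly).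

DEFINITION REQUESTS. None needed to open (flow map, endpoint map, fibres, embedded discs and 3-cells
are spelled inline with Mathlib primitives: HasDerivWithinAt, TendstoUniformly, Set.preimage,
ContinuousOn/Set.InjOn on Metric.closedBall). Nice-to-have later: `IsCellular (K : Set
(EuclideanSpace ℝ (Fin 3)))` and `lagrangianFlow` of a classical solution under
Summits/NavierStokesRegularity/NavierStokesRegularity/Theorems.

Novelty: Searches (2026-08-17): all 57 open + 14 closed Theses grepped for trajector|Lagrangian
flow|endpoint|cellular|decomposition (0 routes use particle-trajectory topology;
VortexLineClock/ThreadingFlux are vortex-LINE objects, HodographBetchov is the velocity hodograph);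
157 idea cards read by title/mechanism (only the spine card; material-singularity-wazewski is
closed, one infalling particle, no census); `lit search --source zbmath "particle trajectories
Navier-Stokes uniqueness Lagrangian"` (4: Robinson–Sadowski CMP 2009, Dashti–Robinson 2009, two
compressible); `lit galaxy search --star all` for "almost everywhere uniqueness of Lagrangian
trajectories" (0), "Lagrangian trajectories for weak solutions of the Navier" (0), "flow map at the
blow-up time" (0), "near-homeomorphism" (9, all pure topology: Daverman, Macías, van Mill),
"cellular decomposition" (18, none fluid); `lit frontier NavierStokesRegularity --since 2025` (30
rows: non-uniqueness, forward self-similar, ε-regularity — none Lagrangian-topological);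
openalex/s2/arxiv remote tiers rate-limited this session (429), noted.
Nearest prior art found: doi:10.1088/0951-7715/22/9/002 (Robinson–Sadowski 2009: a.e. uniqueness of
Lagrangian trajectories for suitable weak solutions — measure, not topology, no endpoint map);
Tao2011 Prop. 9.1 (the bound, used there for enstrophy localisation); Daverman1986 /
doi:10.1090/memo/0107 (cellularity of point inverses of near-homeomorphisms, never applied to
fluids).
Delta: take the unif  [refs: 10.1088/0951-7715/22/9/002, 10.1090/memo/0107, doi:10.1088/0951-7715/22/9/002, doi:10.1090/memo/0107, Tao2011, Daverman1986]

Barriers (technique_class: lagrangian-topology, blowup-classification): - technique_class: lagrangian-topology, blowup-classification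
- Literature.Barriers.NavierStokesRegularity.TaoAveragedBlowup: evaded structurally — averaged
bilinear forms (and the in-tree averaged Type-I pump
Theorems.PerpetualPumpAveragedTypeIBlowup.AveragedTypeIBlowup_of) have no transport structure, no
particle-trajectory map, no volume-preserving flow and no Kelvin theorem, so none of the three
cruxes can be formulated in that class; the route names its fine-structure input (material transport
by u itself).
- Literature.Barriers.NavierStokesRegularity.EnergySupercriticality: the supercritical
bounded-total-speed bound is used only QUALITATIVELY (existence/continuity of Xs); the extracted
information is topological and cannot be degraded by rescaling; conceded that supercriticality bites
INSIDE NoDiscSwallow (the tornado), where the bet is Kelvin on membrane loops + viscous leakage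
through a shrinking perimeter — structure, not size.
- Literature.Barriers.NavierStokesRegularity.SingularSetDimensionBound: used as input (𝓟¹(S) = 0 ⇒
singular fibres over a compact totally disconnected set; regular fibres trivial), consistent.
- Literature.Barriers.NavierStokesRegularity.AxisymmetricTypeIExclusion: consistent — it forces the
axisymmetric disc swallow (Hou) to be Type II, which is why the Type-I/not-Type-I split of
NoDiscSwallow is the first layer-2 move.
- Literature.Barriers.NavierStokesRegularity.LeraySelfSimilarBlowupExclusion: consistent; for
self-similar/DSS Type-I frame

History (route lifecycle, newest last):
- 2026-08-24T09:53:08Z · DORMANT — reconciler: no traction for 6.7 d (last activity item-evidence-added at 2026-08-17T16:57:02Z); parked, not closed — `ledger route dormant route-NavierStokesRegu (operator:999:802523)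
- 2026-08-27T05:13:37Z · REACTIVATED — reconciler: reactivated — activity statement-closed at 2026-08-27T03:59:21Z after parking at 2026-08-24T09:53:08Z (operator:999:1504516)
- 2026-09-01T12:17:20Z · DORMANT — reconciler: no traction for 5 d (last activity statement-closed at 2026-08-27T11:25:11Z); parked, not closed — `ledger route dormant route-NavierStokesRegularit (operator:999:3793661)

sub-problem: NavierStokesRegularity · status: dormant · opened planner-plan-novel-NavierStokesRegularity-Navie-a989c6c0-v2-g15-0 2026-08-17T02:03:57Z · rev 1 · ledger route-NavierStokesRegularity-SwallowedContinuum
GENERATED by the gate from the ledger (D-0016/17). Provers cite these decls: `theorem foo : Summit.NavierStokesRegularity.NavierStokesRegularity.Theses.SwallowedContinuum.<Decl> := …` in Summits/NavierStokesRegularity/NavierStokesRegularity/Theorems/<Name>.lean.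
-/

namespace Summit.NavierStokesRegularity.NavierStokesRegularity.Theses.SwallowedContinuum

open scoped BigOperators Topology Manifold Classical MeasureTheory ProbabilityTheory Matrix InnerProductSpace ComplexConjugate ContinuousMap
open Filter Set Function TopologicalSpace MeasureTheory

attribute [summit_statement] _root_.NavierStokesRegularity

open Literature.NS

/-- item stmt-NavierStokesRegularity-17612 · crux · rank 2 · open · by planner
why it might fail: this is exactly the tornado: Hou's interior axisymmetric candidate (arXiv:2107.06509) swallows the equatorial disc; axisymmetric Type I is excluded (KNSS2009), so the disc sector is Type II, where Kelvin-on-membrane-loops is the amplification mechanism, not yet an obstruction.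
sources: Hou2022PotentiallySingularNS, arXiv:2107.06509, KNSS2009, SereginSverak2009, LuoHou2014, Tao2011
[crux] for every ν>0, T>0, every classical solution (u,p) of unforced NS on ℝ³×[0,T) that is
Leray–Hopf on [0,T] from a rapidly decaying datum, every flow map X of u on [0,T) (X(0,a)=a,
∂ₛX(s,a)=u(s,X(s,a)) within [0,T)) and every uniform limit Xs of X(t,·) as t↑T: no fibre Xs⁻¹{x}
contains the image of the closed unit 2-disc under a map continuous and injective on it (no MEMBRANE
is swallowed; card K1, the tornado sector). [difficulty: open-problem] -/
@[route_item "route-NavierStokesRegularity-SwallowedContinuum", crux]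
def NoDiscSwallow : Prop :=
  ∀ (ν T : ℝ), 0 < ν → 0 < T → ∀ (u : ℝ → EuclideanSpace ℝ (Fin 3) → EuclideanSpace ℝ (Fin 3)) (p : ℝ → EuclideanSpace ℝ (Fin 3) → ℝ), Literature.Analysis.FluidPDE.IsClassicalNSSolutionOn (Set.Ico 0 T) ν 0 u p → Literature.Analysis.FluidPDE.IsLerayHopfOn T ν 0 (u 0) u → Literature.Analysis.FluidPDE.HasRapidSpatialDecay (u 0) → ∀ (X : ℝ → EuclideanSpace ℝ (Fin 3) → EuclideanSpace ℝ (Fin 3)) (Xs : EuclideanSpace ℝ (Fin 3) → EuclideanSpace ℝ (Fin 3)), (∀ a, X 0 a = a) → (∀ a, ∀ t ∈ Set.Ico 0 T, HasDerivWithinAt (fun s => X s a) (u t (X t a)) (Set.Ico 0 T) t) → TendstoUniformly X Xs (nhdsWithin T (Set.Iio T)) → ∀ x : EuclideanSpace ℝ (Fin 3), ¬ ∃ φ : EuclideanSpace ℝ (Fin 2) → EuclideanSpace ℝ (Fin 3), ContinuousOn φ (Metric.closedBall 0 1) ∧ Set.InjOn φ (Metric.closedBall 0 1) ∧ Set.MapsTo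 φ (Metric.closedBall 0 1) (Xs ⁻¹' {x})

/-- item stmt-NavierStokesRegularity-17613 · crux · rank 3 · open · by planner
why it might fail: axial-strain collapses (Elgindi's C^{1,α} Euler blow-up crushes a material axis segment; antiparallel/iterated-sheet scenarios) are arc-type; vortex-layer zoom limits are unstable rather than provably harmless; a 2-dim swallowed continuum with no disc also falsifies it as typed.
sources: Elgindi2021, doi:10.1007/s00205-019-01419-1, BrennerHormozPumir2016, ChenHou2022, Tao2011
[crux] same hypotheses: every NONDEGENERATE fibre Xs⁻¹{x} (more than one label swallowed) contains
the image of the closed unit 2-disc under a map continuous and injective on it — i.e. a first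
singularity never swallows only a disc-free continuum (material arc / dendrite crushed to a point:
one contracting direction, sheet-forming strain; card K2). [difficulty: open-problem] -/
@[route_item "route-NavierStokesRegularity-SwallowedContinuum", crux]
def NoDiscFreeCollapse : Prop :=
  ∀ (ν T : ℝ), 0 < ν → 0 < T → ∀ (u : ℝ → EuclideanSpace ℝ (Fin 3) → EuclideanSpace ℝ (Fin 3)) (p : ℝ → EuclideanSpace ℝ (Fin 3) → ℝ), Literature.Analysis.FluidPDE.IsClassicalNSSolutionOn (Set.Ico 0 T) ν 0 u p → Literature.Analysis.FluidPDE.IsLerayHopfOn T ν 0 (u 0) u → Literature.Analysis.FluidPDE.HasRapidSpatialDecay (u 0) → ∀ (X : ℝ → EuclideanSpace ℝ (Fin 3) → EuclideanSpace ℝ (Fin 3)) (Xs : EuclideanSpace ℝ (Fin 3) → EuclideanSpace ℝ (Fin 3)), (∀ a, X 0 a = a) → (∀ a, ∀ t ∈ Set.Ico 0 T, HasDerivWithinAt (fun s => X s a) (u t (X t a)) (Set.Ico 0 T) t) → TendstoUniformly X Xs (nhdsWithin T (Set.Iio T)) → ∀ x : EuclideanSpace ℝ (Fin 3), ¬ (Xs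 ⁻¹' {x}).Subsingleton → ∃ φ : EuclideanSpace ℝ (Fin 2) → EuclideanSpace ℝ (Fin 3), ContinuousOn φ (Metric.closedBall 0 1) ∧ Set.InjOn φ (Metric.closedBall 0 1) ∧ Set.MapsTo φ (Metric.closedBall 0 1) (Xs ⁻¹' {x})

/-- item stmt-NavierStokesRegularity-17614 · crux · rank 4 · open · by planner
why it might fail: a confined infinitely-winding swirl (Θ ~ r^{-1/2}) has a homeomorphic endpoint map yet unbounded velocity: collision-free blow-up is KINEMATICALLY admissible under bounded total speed, so the crux needs dynamics (spin-up without radial inflow), and no tool for that is in print.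
sources: doi:10.1088/0951-7715/22/9/002, Tao2011, ConstantinIgnatovaVicol2026, BealeKatoMajda1984
[crux] same hypotheses: if the endpoint map Xs is injective (no two fluid particles collide at time
T; every swallowed set is a single label) then u extends as a classical solution past T — "what
blows up must bring fluid particles together" (card K3, the point sector). [difficulty:
open-problem] -/
@[route_item "route-NavierStokesRegularity-SwallowedContinuum", crux]
def NoCollisionFreeBlowup : Prop :=
  ∀ (ν T : ℝ), 0 < ν → 0 < T → ∀ (u : ℝ → EuclideanSpace ℝ (Fin 3) → EuclideanSpace ℝ (Fin 3)) (p : ℝ → EuclideanSpace ℝ (Fin 3) → ℝ), Literature.Analysis.FluidPDE.IsClassicalNSSolutionOn (Set.Ico 0 T) ν 0 u p → Literature.Analysis.FluidPDE.IsLerayHopfOn T ν 0 (u 0) u → Literature.Analysis.FluidPDE.HasRapidSpatialDecay (u 0) → ∀ (X : ℝ → EuclideanSpace ℝ (Fin 3) → EuclideanSpace ℝ (Fin 3)) (Xs : EuclideanSpace ℝ (Fin 3) → EuclideanSpace ℝ (Fin 3)), (∀ a, X 0 a = a) → (∀ a, ∀ t ∈ Set.Ico 0 T, HasDerivWithinAt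 (fun s => X s a) (u t (X t a)) (Set.Ico 0 T) t) → TendstoUniformly X Xs (nhdsWithin T (Set.Iio T)) → Function.Injective Xs → Literature.Analysis.FluidPDE.HasSmoothExtensionPast ν 0 u T

/-- item stmt-NavierStokesRegularity-17615 · support · rank 9 · closed · proved by Summit.NavierStokesRegularity.NavierStokesRegularity.Theorems.swallowedContinuum_endpointMapExists_proof (prover) · by planner
sources: Tao2011, FoiasGuillopeTemam1981, RobinsonRodrigoSadowski2016
[support] for every classical Leray–Hopf solution from a rapidly decaying datum on [0,T) there exist
a flow map X on [0,T) and a uniform limit Xs of X(t,·) as t↑T (Picard–Lindelöf for the bounded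
smooth field on each [0,t], t<T — u is the mild H^k solution by weak–strong uniqueness — and the
Cauchy criterion from bounded total speed, Tao 2013 Prop. 9.1, in tree as
tao2011_boundedTotalSpeed_unit after ν-scaling). The only binder of `closes` that is not a crux.
[difficulty: M] -/
@[route_item "route-NavierStokesRegularity-SwallowedContinuum", crux]
def EndpointMapExists : Prop :=
  ∀ (ν T : ℝ), 0 < ν → 0 < T → ∀ (u : ℝ → EuclideanSpace ℝ (Fin 3) → EuclideanSpace ℝ (Fin 3)) (p : ℝ → EuclideanSpace ℝ (Fin 3) → ℝ), Literature.Analysis.FluidPDE.IsClassicalNSSolutionOn (Set.Ico 0 T) ν 0 u p → Literature.Analysis.FluidPDE.IsLerayHopfOn T ν 0 (u 0) u → Literature.Analysis.FluidPDE.HasRapidSpatialDecay (u 0) → ∃ (X : ℝ → EuclideanSpace ℝ (Fin 3) → EuclideanSpace ℝ (Fin 3)) (Xs : EuclideanSpace ℝ (Fin 3) → EuclideanSpace ℝ (Fin 3)), (∀ a, X 0 a = a) ∧ (∀ a, ∀ t ∈ Set.Ico 0 T, HasDerivWithinAt (fun s => X s a) (u t (X t a)) (Set.Ico 0 T) t)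 ∧ TendstoUniformly X Xs (nhdsWithin T (Set.Iio T))

-- `EndpointMapExists` holds: proved by `Summit.NavierStokesRegularity.NavierStokesRegularity.Theorems.swallowedContinuum_endpointMapExists_proof` (its module imports this route file, so no `_holds` link can be stated here).

/-- item stmt-NavierStokesRegularity-17616 · support · rank 9 · open · by planner
sources: Daverman1986, doi:10.1090/memo/0107, doi:10.1016/0040-9383(72)90014-6, Tao2011
[support] same hypotheses: every nonempty fibre Xs⁻¹{x} is CELLULAR — inside every open
neighbourhood U it lies in the interior of an embedded closed 3-cell e(B̄³) ⊆ U (Xs is a proper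
near-homeomorphism: Bing's shrinkability criterion ⇔ near-homeomorphism for the induced usc
decomposition, and elements of shrinkable decompositions of 3-manifolds are cellular, Daverman1986
§II.5 and §II.6 Prop. 1; Armentrout 1971 for cellular maps of 3-manifolds). Hence swallowed sets are
compact, connected, Lebesgue-null, contain no circle or closed surface. Not a binder of `closes`
(structure behind the census). [difficulty: XL] -/
@[route_item "route-NavierStokesRegularity-SwallowedContinuum"]
def FibreCellular : Prop :=
  ∀ (ν T : ℝ), 0 < ν → 0 < T → ∀ (u : ℝ → EuclideanSpace ℝ (Fin 3) → EuclideanSpace ℝ (Fin 3)) (p : ℝ → EuclideanSpace ℝ (Fin 3) → ℝ), Literature.Analysis.FluidPDE.IsClassicalNSSolutionOn (Set.Ico 0 T) ν 0 u p → Literature.Analysis.FluidPDE.IsLerayHopfOn T ν 0 (u 0) u → Literature.Analysis.FluidPDE.HasRapidSpatialDecay (u 0) → ∀ (X : ℝ → EuclideanSpace ℝ (Fin 3) → EuclideanSpace ℝ (Fin 3)) (Xs : EuclideanSpace ℝ (Fin 3) → EuclideanSpace ℝ (Fin 3)), (∀ a, X 0 a = a) → (∀ a, ∀ t ∈ Set.Ico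 0 T, HasDerivWithinAt (fun s => X s a) (u t (X t a)) (Set.Ico 0 T) t) → TendstoUniformly X Xs (nhdsWithin T (Set.Iio T)) → ∀ x : EuclideanSpace ℝ (Fin 3), (Xs ⁻¹' {x}).Nonempty → ∀ U : Set (EuclideanSpace ℝ (Fin 3)), IsOpen U → Xs ⁻¹' {x} ⊆ U → ∃ e : EuclideanSpace ℝ (Fin 3) → EuclideanSpace ℝ (Fin 3), ContinuousOn e (Metric.closedBall 0 1) ∧ Set.InjOn e (Metric.closedBall 0 1) ∧ e '' Metric.closedBall 0 1 ⊆ U ∧ Xs ⁻¹' {x} ⊆ interior (e '' Metric.closedBall 0 1)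

/-- item stmt-NavierStokesRegularity-17617 · support · rank 9 · closed · proved by Summit.NavierStokesRegularity.NavierStokesRegularity.Theorems.swallowedContinuum_regularFibreTrivial_proof (prover) · by planner
sources: doi:10.1088/0951-7715/22/9/002, CaffarelliKohnNirenberg1982, LemarieRieusset2016
[support] same hypotheses: over a point x near which u stays bounded up to T from below (∃ r, M: ‖u‖
≤ M on B(x,r)×[T−r²,T)) the fibre Xs⁻¹{x} has at most one label (interior regularity gives a
Lipschitz field up to T near x; backward ODE uniqueness through the common endpoint). Hence
nondegenerate swallowed sets sit only over singular points. Provable now; not a binder of `closes`.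
[difficulty: provable-now] -/
@[route_item "route-NavierStokesRegularity-SwallowedContinuum"]
def RegularFibreTrivial : Prop :=
  ∀ (ν T : ℝ), 0 < ν → 0 < T → ∀ (u : ℝ → EuclideanSpace ℝ (Fin 3) → EuclideanSpace ℝ (Fin 3)) (p : ℝ → EuclideanSpace ℝ (Fin 3) → ℝ), Literature.Analysis.FluidPDE.IsClassicalNSSolutionOn (Set.Ico 0 T) ν 0 u p → Literature.Analysis.FluidPDE.IsLerayHopfOn T ν 0 (u 0) u → Literature.Analysis.FluidPDE.HasRapidSpatialDecay (u 0) → ∀ (X : ℝ → EuclideanSpace ℝ (Fin 3) → EuclideanSpace ℝ (Fin 3)) (Xs : EuclideanSpace ℝ (Fin 3) → EuclideanSpace ℝ (Fin 3)), (∀ a, X 0 a = a) → (∀ a, ∀ t ∈ Set.Ico 0 T, HasDerivWithinAt (fun s => X s a) (u t (X t a)) (Set.Ico 0 T) t) → TendstoUniformly X Xs (nhdsWithin T (Set.Iio T)) → ∀ x : EuclideanSpace ℝ (Fin 3), (∃ r > 0, ∃ M : ℝ, ∀ t ∈ Set.Ico (T - r ^ 2) T, ∀ y ∈ Metric.ball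 x r, ‖u t y‖ ≤ M) → (Xs ⁻¹' {x}).Subsingleton

-- `RegularFibreTrivial` holds: proved by `Summit.NavierStokesRegularity.NavierStokesRegularity.Theorems.swallowedContinuum_regularFibreTrivial_proof` (its module imports this route file, so no `_holds` link can be stated here).

/-- item stmt-NavierStokesRegularity-17618 · assembly · rank 1 · closed · proved by Summit.NavierStokesRegularity.NavierStokesRegularity.Theorems.swallowedContinuum_assembly_proof (prover) · by planner
sources: Fefferman2000, Tao2011
[assembly] NoDiscSwallow → NoDiscFreeCollapse → NoCollisionFreeBlowup → EndpointMapExists →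
NavierStokesRegularity. -/
@[route_item "route-NavierStokesRegularity-SwallowedContinuum"]
def Assembly : Prop :=
  NoDiscSwallow → NoDiscFreeCollapse → NoCollisionFreeBlowup → EndpointMapExists → NavierStokesRegularity

-- `Assembly` holds: proved by `Summit.NavierStokesRegularity.NavierStokesRegularity.Theorems.swallowedContinuum_assembly_proof` (its module imports this route file, so no `_holds` link can be stated here).

/-! D-0027 §2.1 — DECIDING THEOREM (planner-authored via `route open/edit --closes-file`; by planner-plan-novel-NavierStokesRegularity-Navie-a989c6c0-v2- 2026-08-17T02:03:57Z):
its hypotheses are this route's items and its conclusion the sub-problem Statement (glue_lint), and it elaborates with this file. -/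

@[closes "route-NavierStokesRegularity-SwallowedContinuum"] theorem closes (h₁ : NoDiscSwallow) (h₂ : NoDiscFreeCollapse) (h₃ : NoCollisionFreeBlowup)
    (h₄ : EndpointMapExists) : NavierStokesRegularity := by
  -- NoBlowupToClay (stmt-NavierStokesRegularity-0055) is PROVED in tree; invoke it by name.
  apply _root_.Summit.NavierStokesRegularity.NavierStokesRegularity.Theorems.typeICertificateLadder_noBlowupToClay_proof
  intro ν T hν hT u p hcl hLH hdec
  obtain ⟨X, Xs, h0, hode, hlim⟩ := h₄ ν T hν hT u p hcl hLH hdec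
  refine h₃ ν T hν hT u p hcl hLH hdec X Xs h0 hode hlim ?_
  intro a b hab
  by_contra hne
  have hns : ¬ (Xs ⁻¹' {Xs a}).Subsingleton := by
    intro hs
    exact hne (hs (by simp) (by simp [hab]))
  obtain ⟨φ, hφ⟩ := h₂ ν T hν hT u p hcl hLH hdec X Xs h0 hode hlim (Xs a) hns
  exact h₁ ν T hν hT u p hcl hLH hdec X Xs h0 hode hlim (Xs a) ⟨φ, hφ⟩

end Summit.NavierStokesRegularity.NavierStokesRegularity.Theses.SwallowedContinuum
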